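import Summits.QuantumFields.YangMills.Theorems.BalabanUVNodesN15TwoGridTransports
import HarnessLib

/-!
# Route «BalabanUVNodes», node N15 = NE2, -a lane, part 35: THE LAPLACIAN CONSISTENCY OF THE CONFORMING TWO-GRID TRANSPORT IN DIVERGENCE FORM —
# `Δ′P̂₂ − P̂₂Δ = Σ_ν ∂′_ν∘ρ′(k_ν)∘P∘∂_ν²` with `‖ρ′(k_ν)‖ ≤ 2η`, and the input swap `‖(P̂₂ − P)u‖ ≤ 2Σ_ν‖(τ_ν − 1)u‖`

Cell `pub-ymgap`, seat `pub-ymgap-dag-n15-a` (KNIT-BY-NAME, g11; D-0062; chair R424 venue; `bears_on: R4∕N15`); `--supports stmt-QuantumFields-19910 --as helper`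
(dag-lead WORDS-133∕134).  Door (iv) of `HOME/pub-ymgap-dag-n15-a/DOOR-IV-PLAN.md` §7.1(ii), route R file R2, over part 34 `…N15TwoGridTransports` (p490970:
the symbol map `symbOp = ρ`, symbols `sT∕sA∕sBt∕sD∕sSm`, `∂′_κA_κP = P∂_κ`, `P − P̂₂ = Σ∂′_νH⁰_ν`).  The position-space resolvent identity
`T4EtaRateDefect.idef_inv` reads `𝔇(G′, G) = −G′·(Δ′_aτ₂ − τ₁Δ_a)·G`; for the vector Laplacian part of [B5]'s `Δ_a = Δ − ∂P∂* + aQ*Q` (1.69)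
(`B5Prop11Lower.Lap = Σ_ν(fdiff ν)ᴴfdiff ν`, componentwise `Σ_ν∇_ν^*∇_ν`) this file proves that with the conforming output transport `τ₂ = P̂₂ = ρ′(Π_νa_ν²)∘P`
the consistency operator is a fine DIVERGENCE of `O(η)`-small operators applied to prolongated coarse SECOND DIFFERENCE QUOTIENTS — the printed currency of
[B5] Prop. 1.2 ((1.110) «G∇*J» for `G′`, gradient differences of `u = Gλ` for `G`), never `η⁻¹`, never `η|∇∇u|` alone (plan §7.1(ii)).  EXISTING COUSIN (cited, not
restated): `RegularTowerSubdivisionSecond.subdiv_tau_tau_sub` (cell `pub-balaban`; second differences of the `E`-valued pointwise `subdiv`, `ℂ`-normed) — not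
consumable by the ℝ-linear `idef`∕`HasMaj` lineage (part 34 header).  Method: ONE commutative-ring identity per direction in the group algebra (`lapDir_comm_symbol`,
by `linear_combination` from the four relations `ss⁻¹ = 1`, `(s−1)Σ_{j<R}s^j = s^R − 1`, `(s−1)(Σ_{j<R−1}s^j)s = s^R − s`, `(s−1)b̃ = Σs^j − R`), transported by
`symbOp` and by the INTERTWINING CALCULUS of §7 (coarse symbols pushed through `P = pull kingPrV`: `s ↦ s′^{L^m}`, `s⁻¹ ↦ s′^{−L^m}`, closed under `+ − * • ^ Σ`).
CONTENTS.  §6 symbols `sTinv` (`s⁻¹`), `sLapDir ν c = −s_ν⁻¹(c(s_ν−1))²`, `sLap c = Σ_ν sLapDir`, `sLapDirR ν R c = −s_ν^{−R}(c(s_ν^R−1))²` (pushed-through coarse),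
`sK ν R c′ = (c′)⁻¹s_ν^{−R}(R⁻¹b̃_ν(1+a_ν) − Σ_{j<R−1}s_ν^j)Π_{μ≠ν}a_μ²`; `sT_mul_sTinv`, `sTinv_pow`, `symbOp_sTinv_apply`, `symbOp_sLapDir_apply`
(`= c²(2f(x) − f(x+e_ν) − f(x−e_ν))`), `sT_sub_one_mul_sBt`, ★ **`lapDir_comm_symbol`** (`sLapDir(cR)·sSm − sSm·sLapDirR(c) = sD(cR)·sK·(c(s^R−1))²`).
§7 `comp_pull_mul∕add∕sub∕smul∕neg∕one∕pow∕sum`, `kingPr_sub_smul_unitVec`, `symbOp_sTinv_pow_comp_pull`, `symbOp_stepDiff_sq_comp_pull` (`ρ′((c(s′^{L^m}−1))²)∘P =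
P∘ρ((c(s−1))²)`), `symbOp_sLapDirR_comp_pull`, ★★ **`lap_sSm_comm_comp_pull`** (the display in the title, as an identity of linear maps `V_η → V_{η′}`).
§8 `norm_symbOp_sTinv_pow_le`, ★ `norm_symbOp_sK_le` (`≤ 2(R−1)∕c′·‖f‖`), `floorMap_add_smul_unitVec_of_le` ∕ `kingPr_add_smul_unitVec_of_le`
(`j ≤ L^m` fine steps move King's pairing by at most one coarse step), `norm_symbOp_sT_pow_sub_one_pull_le`, ★ `norm_symbOp_sA_sub_one_pull_le` (`‖(A_κ−1)Pu‖ ≤ ‖(τ_κ−1)u‖`),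
★ **`norm_symbOp_sSm_sub_one_pull_le`** (`‖(P̂₂−P)u‖ ≤ 2Σ_ν‖(τ_ν−1)u‖`, uniform in `m`), ★ `norm_symbOp_sK_fine_le` (`c′ = L^kL^m`, `R = L^m`: `‖ρ′(k_ν)w‖ ≤ 2L^{−k}‖w‖`).
Plumbing defs are DATA (five symbols; no `Prop`-valued def); every theorem is [folklore] lattice algebra.
HONEST FRAMING ∕ LIMITS.  Finite-dimensional lattice algebra + sup-norm bookkeeping on finite tori; the `aQ*Q` and `∂P∂*` parts of `Δ_a` and the (3.42) entries of
`G₀`∕`G` are the sequel R3 (inputs named in the plan: `prop12Printed_famDiagTop`, part 20's `abs_lineWeight_pair_sub_le`), NOT here; no estimate of [B5]∕[B9];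
nothing with a background; NOT Node 00; count-neutral (typed 28∕28 · discharged 5∕28 unchanged); NOT a discharge of N15 (object-bound; NE2⁺ NOT PRINTED);
`U ≡ 1` torus MODEL; one finite T⁴ at fixed ε — NOT infinite volume, NOT OS on ℝ⁴, NOT a mass gap, NOT Clay.
-/

noncomputable section
open scoped BigOperators
open Finset
namespace Summit.QuantumFields.YangMills.BalabanUVNodes.N15.TwoGrid
open Literature.MathematicalPhysics.QuantumFieldTheory.Balaban1983to89
open Literature.MathematicalPhysics.QuantumFieldTheory.Balaban1983to89.T4EtaRateCoeffDefect (pull pull_apply)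
open Literature.MathematicalPhysics.QuantumFieldTheory.Balaban1983to89.B5Prop11Plancherel (Tor fine unitVec)
open Summit.QuantumFields.YangMills.BalabanUVNodes.N15.VectorPiece (kingPr kingPrV kingPr_val kingPrV_eq)
variable {d : ℕ}
/-! ## §6 The backward shift symbol, the lattice Laplacian symbol, coarse second differences -/
section LapSymbols
variable (M : Fin (d + 1) → ℕ) (n : ℕ)
/-- the BACKWARD SHIFT SYMBOL `s_κ⁻¹ = [−e_κ]`. [folklore] -/
def sTinv (κ : Fin (d + 1)) : AddMonoidAlgebra ℝ (Tor (fine n M)) := AddMonoidAlgebra.single (-unitVec (fine n M) κ) 1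

/-- `s_κ · s_κ⁻¹ = 1`. [folklore] -/
theorem sT_mul_sTinv (κ : Fin (d + 1)) : sT M n κ * sTinv M n κ = 1 := by
  rw [sT, sTinv, AddMonoidAlgebra.single_mul_single, add_neg_cancel, mul_one, AddMonoidAlgebra.one_def]

/-- powers of the backward shift: `s_κ^{−j} = [−j e_κ]`. [folklore] -/
theorem sTinv_pow (κ : Fin (d + 1)) (j : ℕ) : sTinv M n κ ^ j = AddMonoidAlgebra.single (-(j • unitVec (fine n M) κ)) 1 := by
  rw [sTinv, AddMonoidAlgebra.single_pow, one_pow, smul_neg]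

/-- the DIRECTIONAL LAPLACIAN SYMBOL `−c²·s_ν⁻¹(s_ν − 1)² = c²(2 − s_ν − s_ν⁻¹)`: `ρ` of it is `∇_ν^*∇_ν` with lattice factor `c`
(`B5Prop11Lower.Lap = Σ_ν (fdiff ν)ᴴ fdiff ν` componentwise, at `c = n`). [cite: Balaban1984PropagatorsI, (1.21) p.21, (1.31) p.23 (Δ(p) = Σ|∂_μ(p)|²)] -/
def sLapDir (ν : Fin (d + 1)) (c : ℝ) : AddMonoidAlgebra ℝ (Tor (fine n M)) := -(sTinv M n ν * sD M n ν c ^ 2)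

/-- the LAPLACIAN SYMBOL `Σ_ν −c² s_ν⁻¹(s_ν − 1)²`. [cite: Balaban1984PropagatorsI, (1.21) p.21] -/
def sLap (c : ℝ) : AddMonoidAlgebra ℝ (Tor (fine n M)) := ∑ ν : Fin (d + 1), sLapDir M n ν c

/-- the COARSE directional Laplacian symbol PUSHED THROUGH the prolongation: `−c²·s_ν^{−R}(s_ν^R − 1)²` (coarse steps = `R` fine steps). [folklore] -/
def sLapDirR (ν : Fin (d + 1)) (R : ℕ) (c : ℝ) : AddMonoidAlgebra ℝ (Tor (fine n M)) :=
  -(sTinv M n ν ^ R * (c • (sT M n ν ^ R - 1)) ^ 2)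

/-- the CONSISTENCY SYMBOLS `k_ν = (c′)⁻¹·s_ν^{−R}·(R⁻¹b̃_ν(1 + a_ν) − Σ_{j<R−1}s_ν^j)·Π_{μ≠ν}a_μ²` of the Laplacian commutator. [folklore] -/
def sK (ν : Fin (d + 1)) (R : ℕ) (c' : ℝ) : AddMonoidAlgebra ℝ (Tor (fine n M)) :=
  c'⁻¹ • ((sTinv M n ν ^ R * (((R : ℝ)⁻¹ • (sBt M n ν R * (1 + sA M n ν R))) - ∑ j ∈ range (R - 1), sT M n ν ^ j)) *
    ∏ μ ∈ univ.erase ν, sA M n μ R ^ 2)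

/-- `ρ(s_κ⁻¹)`, pointwise: `f(x − e_κ, a)` (n15-c's `bshiftV`). [folklore] -/
theorem symbOp_sTinv_apply (κ : Fin (d + 1)) (f : Tor (fine n M) × Fin (d + 1) → ℝ) (i : Tor (fine n M) × Fin (d + 1)) :
    symbOp M n (sTinv M n κ) f i = f (i.1 - unitVec (fine n M) κ, i.2) := by
  rw [sTinv, symbOp_single_apply, one_mul, sub_eq_add_neg]

/-- THE DIRECTIONAL LAPLACIAN, pointwise: `(ρ(−c²s⁻¹(s − 1)²)f)(x, a) = c²(2f(x, a) − f(x + e_ν, a) − f(x − e_ν, a))`. [cite: Balaban1984PropagatorsI, (1.21) p.21] -/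
theorem symbOp_sLapDir_apply (ν : Fin (d + 1)) (c : ℝ) (f : Tor (fine n M) × Fin (d + 1) → ℝ) (i : Tor (fine n M) × Fin (d + 1)) :
    symbOp M n (sLapDir M n ν c) f i = c ^ 2 * (2 * f i - f (i.1 + unitVec (fine n M) ν, i.2) - f (i.1 - unitVec (fine n M) ν, i.2)) := by
  rw [sLapDir, map_neg, map_mul, map_pow, LinearMap.neg_apply, Pi.neg_apply, Module.End.mul_apply, symbOp_sTinv_apply, pow_two,
    Module.End.mul_apply, symbOp_sD_apply, symbOp_sD_apply, symbOp_sD_apply, sub_add_cancel]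
  ring

/-- `(s_κ − 1)·b̃_κ = Σ_{j<R}s_κ^j − R·1` (the telescoped partial sums). [folklore] -/
theorem sT_sub_one_mul_sBt (κ : Fin (d + 1)) (R : ℕ) :
    (sT M n κ - 1) * sBt M n κ R = (∑ j ∈ range R, sT M n κ ^ j) - algebraMap ℝ (AddMonoidAlgebra ℝ (Tor (fine n M))) R := by
  rw [sBt, mul_sum, sum_congr rfl fun j _ => sT_sub_one_mul_sum M n κ j, sum_sub_distrib, sum_const, card_range,
    Algebra.algebraMap_eq_smul_one, Nat.cast_smul_eq_nsmul]

/-- ★ **THE LAPLACIAN COMMUTATOR, ONE DIRECTION, AS A SYMBOL IDENTITY**: with fine factor `c′ = cR`,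
`(−c′²s⁻¹(s−1)²)·Π_μa_μ² − Π_μa_μ²·(−c²s^{−R}(s^R−1)²) = [c′(s−1)]·k_ν·[c(s^R−1)]²` — the fine directional Laplacian of the smoothing minus the
smoothing of the pushed-through coarse one is a fine DIFFERENCE (`c′(s−1)`) of an `O(R∕c′)` symbol (`k_ν`) applied to the pushed-through coarse
SECOND difference quotient `(c(s^R − 1))²`.  Relations used: `ss⁻¹ = 1`, `(s−1)Σ_{j<R}s^j = s^R − 1`, `(s−1)Σ_{j<R−1}s^j·s = s^R − s`,
`(s−1)b̃ = Σs^j − R`. [folklore] -/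
theorem lapDir_comm_symbol (ν : Fin (d + 1)) {R : ℕ} (hR : R ≠ 0) {c : ℝ} (hc : c ≠ 0) :
    sLapDir M n ν (c * R) * sSm M n R - sSm M n R * sLapDirR M n ν R c =
      sD M n ν (c * R) * sK M n ν R (c * R) * (c • (sT M n ν ^ R - 1)) ^ 2 := by
  have hR' : (R : ℝ) ≠ 0 := Nat.cast_ne_zero.mpr hR
  have hCR : algebraMap ℝ (AddMonoidAlgebra ℝ (Tor (fine n M))) (R : ℝ)⁻¹ * algebraMap ℝ (AddMonoidAlgebra ℝ (Tor (fine n M))) R = 1 := by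
    rw [← map_mul, inv_mul_cancel₀ hR', map_one]
  have hCc : algebraMap ℝ (AddMonoidAlgebra ℝ (Tor (fine n M))) (c * R)⁻¹ *
      (algebraMap ℝ (AddMonoidAlgebra ℝ (Tor (fine n M))) c * algebraMap ℝ (AddMonoidAlgebra ℝ (Tor (fine n M))) R) = 1 := by
    rw [← map_mul, ← map_mul, inv_mul_cancel₀ (mul_ne_zero hc hR'), map_one]
  have r1 : sT M n ν * sTinv M n ν = 1 := sT_mul_sTinv M n ν
  have r2 : (sT M n ν - 1) * ∑ j ∈ range R, sT M n ν ^ j = sT M n ν ^ R - 1 := sT_sub_one_mul_sum M n ν R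
  have r4 : (sT M n ν - 1) * (∑ j ∈ range (R - 1), sT M n ν ^ j) * sT M n ν = sT M n ν ^ R - sT M n ν := by
    rw [sT_sub_one_mul_sum M n ν (R - 1), sub_mul, one_mul, ← pow_succ, Nat.sub_add_cancel (Nat.pos_of_ne_zero hR)]
  have r6 := sT_sub_one_mul_sBt M n ν R
  have r3 : sT M n ν ^ R * sTinv M n ν ^ R = 1 := by rw [← mul_pow, r1, one_pow]
  rw [show sSm M n R = sA M n ν R ^ 2 * ∏ μ ∈ univ.erase ν, sA M n μ R ^ 2 from
      (mul_prod_erase univ (fun μ => sA M n μ R ^ 2) (mem_univ ν)).symm,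
    sLapDir, sLapDirR, sD, sK, show sA M n ν R = (R : ℝ)⁻¹ • ∑ j ∈ range R, sT M n ν ^ j from rfl]
  simp only [Algebra.smul_def, map_mul]
  set s := sT M n ν; set t := sTinv M n ν; set g := ∑ j ∈ range R, s ^ j; set g' := ∑ j ∈ range (R - 1), s ^ j
  set b := sBt M n ν R; set P' := ∏ μ ∈ univ.erase ν, sA M n μ R ^ 2
  set Cc := algebraMap ℝ (AddMonoidAlgebra ℝ (Tor (fine n M))) c; set CR := algebraMap ℝ (AddMonoidAlgebra ℝ (Tor (fine n M))) (R : ℝ)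
  set CRi := algebraMap ℝ (AddMonoidAlgebra ℝ (Tor (fine n M))) (R : ℝ)⁻¹; set Ci := algebraMap ℝ (AddMonoidAlgebra ℝ (Tor (fine n M))) (c * (R : ℝ))⁻¹
  have H1 : CRi * g * (s - 1) = CRi * (s ^ R - 1) := by linear_combination CRi * r2
  have H2 : (s - 1) * g' = s ^ R * t - 1 := by linear_combination t * r4 - ((s - 1) * g' + 1) * r1
  have E1 : t * (Cc * CR * (s - 1)) ^ 2 * (CRi * g) ^ 2 = Cc ^ 2 * t * (s ^ R - 1) ^ 2 := by
    linear_combination (Cc ^ 2 * t * (CRi * g * (s - 1) + CRi * (s ^ R - 1)) * CR ^ 2) * H1 +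
      (Cc ^ 2 * t * (s ^ R - 1) ^ 2 * (CRi * CR + 1)) * hCR
  have E2 : (s - 1) * (t ^ R * (CRi * (b * (1 + CRi * g)) - g')) = (CRi * g) ^ 2 * t ^ R - t := by
    linear_combination (t ^ R * CRi * (1 + CRi * g)) * r6 - t ^ R * H2 - (t ^ R * CRi * g + t ^ R) * hCR - t * r3
  linear_combination (-P') * E1 - (Cc ^ 2 * (s ^ R - 1) ^ 2 * P') * E2 -
    (Cc ^ 2 * (s ^ R - 1) ^ 2 * P' * ((s - 1) * (t ^ R * (CRi * (b * (1 + CRi * g)) - g')))) * hCc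
end LapSymbols

/-! ## §7 The intertwining calculus: which fine symbols the prolongation turns coarse symbols into -/
section Intertwining
variable (M : Fin (d + 1) → ℕ) (L k m : ℕ)
/-- products intertwine if the factors do. [folklore] -/
theorem comp_pull_mul {x' y' : AddMonoidAlgebra ℝ (Tor (fine (L ^ m * L ^ k) M))} {x y : AddMonoidAlgebra ℝ (Tor (fine (L ^ k) M))}
    (hx : symbOp M (L ^ m * L ^ k) x' ∘ₗ pull (kingPrV L k m M) = pull (kingPrV L k m M) ∘ₗ symbOp M (L ^ k) x)
    (hy : symbOp M (L ^ m * L ^ k) y' ∘ₗ pull (kingPrV L k m M) = pull (kingPrV L k m M) ∘ₗ symbOp M (L ^ k) y) :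
    symbOp M (L ^ m * L ^ k) (x' * y') ∘ₗ pull (kingPrV L k m M) = pull (kingPrV L k m M) ∘ₗ symbOp M (L ^ k) (x * y) := by
  rw [map_mul, map_mul, Module.End.mul_eq_comp, Module.End.mul_eq_comp, LinearMap.comp_assoc, hy, ← LinearMap.comp_assoc, hx,
    LinearMap.comp_assoc]

/-- sums intertwine if the summands do. [folklore] -/
theorem comp_pull_add {x' y' : AddMonoidAlgebra ℝ (Tor (fine (L ^ m * L ^ k) M))} {x y : AddMonoidAlgebra ℝ (Tor (fine (L ^ k) M))}
    (hx : symbOp M (L ^ m * L ^ k) x' ∘ₗ pull (kingPrV L k m M) = pull (kingPrV L k m M) ∘ₗ symbOp M (L ^ k) x)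
    (hy : symbOp M (L ^ m * L ^ k) y' ∘ₗ pull (kingPrV L k m M) = pull (kingPrV L k m M) ∘ₗ symbOp M (L ^ k) y) :
    symbOp M (L ^ m * L ^ k) (x' + y') ∘ₗ pull (kingPrV L k m M) = pull (kingPrV L k m M) ∘ₗ symbOp M (L ^ k) (x + y) := by
  rw [map_add, map_add, LinearMap.add_comp, LinearMap.comp_add, hx, hy]

/-- differences intertwine if the terms do. [folklore] -/
theorem comp_pull_sub {x' y' : AddMonoidAlgebra ℝ (Tor (fine (L ^ m * L ^ k) M))} {x y : AddMonoidAlgebra ℝ (Tor (fine (L ^ k) M))}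
    (hx : symbOp M (L ^ m * L ^ k) x' ∘ₗ pull (kingPrV L k m M) = pull (kingPrV L k m M) ∘ₗ symbOp M (L ^ k) x)
    (hy : symbOp M (L ^ m * L ^ k) y' ∘ₗ pull (kingPrV L k m M) = pull (kingPrV L k m M) ∘ₗ symbOp M (L ^ k) y) :
    symbOp M (L ^ m * L ^ k) (x' - y') ∘ₗ pull (kingPrV L k m M) = pull (kingPrV L k m M) ∘ₗ symbOp M (L ^ k) (x - y) := by
  rw [map_sub, map_sub, LinearMap.sub_comp, LinearMap.comp_sub, hx, hy]

/-- scalar multiples intertwine. [folklore] -/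
theorem comp_pull_smul (r : ℝ) {x' : AddMonoidAlgebra ℝ (Tor (fine (L ^ m * L ^ k) M))} {x : AddMonoidAlgebra ℝ (Tor (fine (L ^ k) M))}
    (hx : symbOp M (L ^ m * L ^ k) x' ∘ₗ pull (kingPrV L k m M) = pull (kingPrV L k m M) ∘ₗ symbOp M (L ^ k) x) :
    symbOp M (L ^ m * L ^ k) (r • x') ∘ₗ pull (kingPrV L k m M) = pull (kingPrV L k m M) ∘ₗ symbOp M (L ^ k) (r • x) := by
  rw [map_smul, map_smul, LinearMap.smul_comp, LinearMap.comp_smul, hx]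

/-- negatives intertwine. [folklore] -/
theorem comp_pull_neg {x' : AddMonoidAlgebra ℝ (Tor (fine (L ^ m * L ^ k) M))} {x : AddMonoidAlgebra ℝ (Tor (fine (L ^ k) M))}
    (hx : symbOp M (L ^ m * L ^ k) x' ∘ₗ pull (kingPrV L k m M) = pull (kingPrV L k m M) ∘ₗ symbOp M (L ^ k) x) :
    symbOp M (L ^ m * L ^ k) (-x') ∘ₗ pull (kingPrV L k m M) = pull (kingPrV L k m M) ∘ₗ symbOp M (L ^ k) (-x) := by
  rw [map_neg, map_neg, LinearMap.neg_comp, LinearMap.comp_neg, hx]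

/-- `1` intertwines. [folklore] -/
theorem comp_pull_one : symbOp M (L ^ m * L ^ k) 1 ∘ₗ pull (kingPrV L k m M) = pull (kingPrV L k m M) ∘ₗ symbOp M (L ^ k) 1 := by
  rw [map_one, map_one, Module.End.one_eq_id, LinearMap.id_comp, Module.End.one_eq_id, LinearMap.comp_id]

/-- powers intertwine if the base does. [folklore] -/
theorem comp_pull_pow {x' : AddMonoidAlgebra ℝ (Tor (fine (L ^ m * L ^ k) M))} {x : AddMonoidAlgebra ℝ (Tor (fine (L ^ k) M))}
    (hx : symbOp M (L ^ m * L ^ k) x' ∘ₗ pull (kingPrV L k m M) = pull (kingPrV L k m M) ∘ₗ symbOp M (L ^ k) x) (j : ℕ) :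
    symbOp M (L ^ m * L ^ k) (x' ^ j) ∘ₗ pull (kingPrV L k m M) = pull (kingPrV L k m M) ∘ₗ symbOp M (L ^ k) (x ^ j) := by
  induction j with
  | zero => rw [pow_zero, pow_zero]; exact comp_pull_one M L k m
  | succ j ih => rw [pow_succ, pow_succ]; exact comp_pull_mul M L k m ih hx

/-- finite sums intertwine if the summands do. [folklore] -/
theorem comp_pull_sum {ι : Type} (S : Finset ι) {x' : ι → AddMonoidAlgebra ℝ (Tor (fine (L ^ m * L ^ k) M))}
    {x : ι → AddMonoidAlgebra ℝ (Tor (fine (L ^ k) M))}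
    (h : ∀ i ∈ S, symbOp M (L ^ m * L ^ k) (x' i) ∘ₗ pull (kingPrV L k m M) = pull (kingPrV L k m M) ∘ₗ symbOp M (L ^ k) (x i)) :
    symbOp M (L ^ m * L ^ k) (∑ i ∈ S, x' i) ∘ₗ pull (kingPrV L k m M) = pull (kingPrV L k m M) ∘ₗ symbOp M (L ^ k) (∑ i ∈ S, x i) := by
  classical
  induction S using Finset.induction_on with
  | empty => rw [sum_empty, sum_empty, map_zero, map_zero, LinearMap.zero_comp, LinearMap.comp_zero]
  | insert i S hi ih =>
      rw [sum_insert hi, sum_insert hi]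
      exact comp_pull_add M L k m (h i (mem_insert_self i S)) (ih fun i' hi' => h i' (mem_insert_of_mem hi'))

variable [∀ μ, NeZero (M μ)] [NeZero L]
/-- KING's PAIRING ONE COARSE STEP BACK: `pr(z − L^me′_κ) = pr z − e_κ`. [cite: King1986, p.664 (pairing convention «x′ ∈ B^n(x)»)] -/
theorem kingPr_sub_smul_unitVec (z : Tor (fine (L ^ m * L ^ k) M)) (κ : Fin (d + 1)) :
    kingPr L k m M (z - L ^ m • unitVec (fine (L ^ m * L ^ k) M) κ) = kingPr L k m M z - unitVec (fine (L ^ k) M) κ := by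
  have h := kingPr_add_smul_unitVec M L k m (z - L ^ m • unitVec (fine (L ^ m * L ^ k) M) κ) κ
  rw [sub_add_cancel] at h; exact eq_sub_of_add_eq h.symm

/-- the backward coarse step intertwines: `τ′_{−L^me′_κ}∘P = P∘τ_{−e_κ}`. [cite: King1986, p.664 (pairing convention)] -/
theorem symbOp_sTinv_pow_comp_pull (κ : Fin (d + 1)) :
    symbOp M (L ^ m * L ^ k) (sTinv M (L ^ m * L ^ k) κ ^ L ^ m) ∘ₗ pull (kingPrV L k m M) =
      pull (kingPrV L k m M) ∘ₗ symbOp M (L ^ k) (sTinv M (L ^ k) κ) := by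
  refine LinearMap.ext fun g => funext fun i => ?_
  rw [LinearMap.comp_apply, LinearMap.comp_apply, sTinv_pow, symbOp_single_apply, one_mul, pull_apply, pull_apply, symbOp_sTinv_apply,
    kingPrV_eq, kingPrV_eq, ← sub_eq_add_neg, kingPr_sub_smul_unitVec]

/-- the coarse-step quotient squared intertwines with the coarse second difference quotient: `ρ′((c(s′^{L^m} − 1))²)∘P = P∘ρ((c(s − 1))²)`. [folklore] -/
theorem symbOp_stepDiff_sq_comp_pull (κ : Fin (d + 1)) (c : ℝ) :
    symbOp M (L ^ m * L ^ k) ((c • (sT M (L ^ m * L ^ k) κ ^ L ^ m - 1)) ^ 2) ∘ₗ pull (kingPrV L k m M) =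
      pull (kingPrV L k m M) ∘ₗ symbOp M (L ^ k) (sD M (L ^ k) κ c ^ 2) :=
  comp_pull_pow M L k m (comp_pull_smul M L k m c (comp_pull_sub M L k m (symbOp_sT_pow_comp_pull M L k m κ) (comp_pull_one M L k m))) 2

/-- the pushed-through directional Laplacian IS the prolongation of the coarse directional Laplacian:
`ρ′(−c²s′^{−L^m}(s′^{L^m} − 1)²)∘P = P∘ρ(−c²s⁻¹(s − 1)²)`. [folklore] -/
theorem symbOp_sLapDirR_comp_pull (κ : Fin (d + 1)) (c : ℝ) :
    symbOp M (L ^ m * L ^ k) (sLapDirR M (L ^ m * L ^ k) κ (L ^ m) c) ∘ₗ pull (kingPrV L k m M) =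
      pull (kingPrV L k m M) ∘ₗ symbOp M (L ^ k) (sLapDir M (L ^ k) κ c) :=
  comp_pull_neg M L k m (comp_pull_mul M L k m (symbOp_sTinv_pow_comp_pull M L k m κ) (symbOp_stepDiff_sq_comp_pull M L k m κ c))

/-- ★★ **THE LAPLACIAN CONSISTENCY OF THE CONFORMING TRANSPORT, IN DIVERGENCE FORM**: with `P̂₂ = ρ′(Π_νa_ν²)∘P`, fine Laplacian `Δ′ = ρ′(Σ_ν −c′²s_ν⁻¹(s_ν−1)²)`
(`c′ = cL^m`) and coarse `Δ = ρ(Σ_ν −c²s_ν⁻¹(s_ν−1)²)`,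
`Δ′∘P̂₂ − P̂₂∘Δ = Σ_ν ∂′_ν ∘ ρ′(k_ν) ∘ P ∘ ∂_ν²` (`∂′_ν = ρ′(c′(s_ν−1))`, `∂_ν² = ρ((c(s_ν−1))²)` the coarse forward second difference quotient) — each term is a
fine DIVERGENCE of an `O(η)`-small operator (`norm_symbOp_sK_le`) applied to a prolongated coarse SECOND DIFFERENCE QUOTIENT: no `L^{2m}∕η` dipoles, no `η⁻¹`. [folklore] -/
theorem lap_sSm_comm_comp_pull {c : ℝ} (hc : c ≠ 0) :
    symbOp M (L ^ m * L ^ k) (sLap M (L ^ m * L ^ k) (c * L ^ m)) ∘ₗ (symbOp M (L ^ m * L ^ k) (sSm M (L ^ m * L ^ k) (L ^ m)) ∘ₗ pull (kingPrV L k m M)) -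
        symbOp M (L ^ m * L ^ k) (sSm M (L ^ m * L ^ k) (L ^ m)) ∘ₗ (pull (kingPrV L k m M) ∘ₗ symbOp M (L ^ k) (sLap M (L ^ k) c)) =
      ∑ ν : Fin (d + 1), symbOp M (L ^ m * L ^ k) (sD M (L ^ m * L ^ k) ν (c * L ^ m) * sK M (L ^ m * L ^ k) ν (L ^ m) (c * L ^ m)) ∘ₗ
        (pull (kingPrV L k m M) ∘ₗ symbOp M (L ^ k) (sD M (L ^ k) ν c ^ 2)) := by
  have hR : (L ^ m : ℕ) ≠ 0 := pow_ne_zero m (NeZero.ne L)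
  -- push the coarse Laplacian through the prolongation
  have hlap : pull (kingPrV L k m M) ∘ₗ symbOp M (L ^ k) (sLap M (L ^ k) c) =
      symbOp M (L ^ m * L ^ k) (∑ ν : Fin (d + 1), sLapDirR M (L ^ m * L ^ k) ν (L ^ m) c) ∘ₗ pull (kingPrV L k m M) :=
    (comp_pull_sum M L k m univ fun ν _ => symbOp_sLapDirR_comp_pull M L k m ν c).symm
  rw [hlap, ← LinearMap.comp_assoc, ← LinearMap.comp_assoc, ← Module.End.mul_eq_comp, ← Module.End.mul_eq_comp, ← LinearMap.sub_comp,
    ← map_mul, ← map_mul, ← map_sub, sLap, sum_mul, mul_sum, ← sum_sub_distrib]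
  have key : ∀ ν : Fin (d + 1), sLapDir M (L ^ m * L ^ k) ν (c * L ^ m) * sSm M (L ^ m * L ^ k) (L ^ m) -
      sSm M (L ^ m * L ^ k) (L ^ m) * sLapDirR M (L ^ m * L ^ k) ν (L ^ m) c =
      sD M (L ^ m * L ^ k) ν (c * L ^ m) * sK M (L ^ m * L ^ k) ν (L ^ m) (c * L ^ m) * (c • (sT M (L ^ m * L ^ k) ν ^ L ^ m - 1)) ^ 2 :=
    fun ν => by
      have h := lapDir_comm_symbol M (L ^ m * L ^ k) ν hR hc
      rwa [Nat.cast_pow] at h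
  rw [sum_congr rfl fun ν _ => key ν, map_sum]
  refine LinearMap.ext fun g => ?_
  rw [LinearMap.comp_apply, LinearMap.sum_apply, LinearMap.sum_apply]
  refine sum_congr rfl fun ν _ => ?_
  have hX := LinearMap.congr_fun (symbOp_stepDiff_sq_comp_pull M L k m ν c) g
  simp only [LinearMap.comp_apply] at hX
  rw [map_mul, Module.End.mul_apply, LinearMap.comp_apply, LinearMap.comp_apply, hX]
end Intertwining

/-! ## §8 Sup-norm bounds: the consistency operators are `O(η)`, the input swap `(P̂₂ − P)u` costs one coarse difference of `u` -/
section Bounds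
variable (M : Fin (d + 1) → ℕ) [∀ μ, NeZero (M μ)] (n : ℕ) [NeZero n]
/-- `‖ρ(s_κ^{−j})f‖ ≤ ‖f‖`. [folklore] -/
theorem norm_symbOp_sTinv_pow_le (κ : Fin (d + 1)) (j : ℕ) (f : Tor (fine n M) × Fin (d + 1) → ℝ) :
    ‖symbOp M n (sTinv M n κ ^ j) f‖ ≤ ‖f‖ := by
  rw [sTinv_pow, symbOp_single, one_smul]
  exact norm_tshiftV_le M n _ f

/-- ★ **THE LAPLACIAN CONSISTENCY SYMBOLS ARE `O(R∕c′)`**: `‖ρ(k_ν)f‖ ≤ (2(R − 1)∕c′)·‖f‖` (`R ≠ 0`, `c′ > 0`): `(c′)⁻¹ × 1 × (R⁻¹·R(R−1)∕2·2 + (R−1)) × 1`.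
[folklore] -/
theorem norm_symbOp_sK_le {R : ℕ} (hR : R ≠ 0) {c' : ℝ} (hc : 0 < c') (ν : Fin (d + 1)) (f : Tor (fine n M) × Fin (d + 1) → ℝ) :
    ‖symbOp M n (sK M n ν R c') f‖ ≤ (2 * ((R : ℝ) - 1) / c') * ‖f‖ := by
  have hR' : (0 : ℝ) < R := by exact_mod_cast Nat.pos_of_ne_zero hR
  have hR1 : (1 : ℝ) ≤ R := by exact_mod_cast Nat.pos_of_ne_zero hR
  have hcast : ((R - 1 : ℕ) : ℝ) = (R : ℝ) - 1 := by rw [Nat.cast_sub (Nat.pos_of_ne_zero hR), Nat.cast_one]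
  set g := symbOp M n (∏ μ ∈ univ.erase ν, sA M n μ R ^ 2) f with hg
  have h1 : ‖g‖ ≤ ‖f‖ := norm_symbOp_prod_sA_sq_le M n hR _ f
  -- the bracket `(R⁻¹·b̃(1+a) − Σ_{j<R−1}s^j) g`
  have h2 : ‖symbOp M n ((R : ℝ)⁻¹ • (sBt M n ν R * (1 + sA M n ν R)) - ∑ j ∈ range (R - 1), sT M n ν ^ j) g‖ ≤ 2 * ((R : ℝ) - 1) * ‖f‖ := by
    rw [map_sub, LinearMap.sub_apply]
    refine (norm_sub_le _ _).trans ?_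
    have hA : ‖symbOp M n ((R : ℝ)⁻¹ • (sBt M n ν R * (1 + sA M n ν R))) g‖ ≤ ((R : ℝ) - 1) * ‖f‖ := by
      rw [map_smul, LinearMap.smul_apply, norm_smul, norm_inv, Real.norm_natCast, map_mul, Module.End.mul_apply]
      have h3 := norm_symbOp_sBt_le M n ν R (symbOp M n (1 + sA M n ν R) g)
      have h4 : ‖symbOp M n (1 + sA M n ν R) g‖ ≤ 2 * ‖f‖ := (norm_symbOp_one_add_sA_le M n ν hR g).trans (by linarith)
      have hRR : 0 ≤ (R : ℝ) * ((R : ℝ) - 1) / 2 := by positivity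
      calc (R : ℝ)⁻¹ * ‖symbOp M n (sBt M n ν R) (symbOp M n (1 + sA M n ν R) g)‖
          ≤ (R : ℝ)⁻¹ * (((R : ℝ) * ((R : ℝ) - 1) / 2) * (2 * ‖f‖)) := by gcongr; exact h3.trans (mul_le_mul_of_nonneg_left h4 hRR)
        _ = ((R : ℝ) - 1) * ‖f‖ := by field_simp
    have hB : ‖symbOp M n (∑ j ∈ range (R - 1), sT M n ν ^ j) g‖ ≤ ((R : ℝ) - 1) * ‖f‖ := by
      rw [map_sum, LinearMap.sum_apply, ← hcast]
      refine (norm_sum_le _ _).trans ((sum_le_sum fun j _ => norm_symbOp_sT_pow_le M n ν j g).trans ?_)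
      rw [sum_const, card_range, nsmul_eq_mul]; exact mul_le_mul_of_nonneg_left h1 (Nat.cast_nonneg _)
    linarith
  rw [sK, map_smul, LinearMap.smul_apply, norm_smul, norm_inv, Real.norm_of_nonneg hc.le, map_mul, Module.End.mul_apply, map_mul, Module.End.mul_apply]
  calc c'⁻¹ * ‖symbOp M n (sTinv M n ν ^ R) (symbOp M n ((R : ℝ)⁻¹ • (sBt M n ν R * (1 + sA M n ν R)) - ∑ j ∈ range (R - 1), sT M n ν ^ j) g)‖
      ≤ c'⁻¹ * (2 * ((R : ℝ) - 1) * ‖f‖) := by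
        gcongr
        exact (norm_symbOp_sTinv_pow_le M n ν R _).trans h2
    _ = (2 * ((R : ℝ) - 1) / c') * ‖f‖ := by ring
end Bounds
section SwapBounds
variable {A B : Fin (d + 1) → ℕ} [∀ μ, NeZero (A μ)] [∀ μ, NeZero (B μ)]
/-- **AT MOST ONE FACE IN `j ≤ R` STEPS**: under a `⌊·∕R⌋` map, `φ(z + je_κ) = φz + δe_κ` with `δ ∈ {0, 1}` whenever `j ≤ R`. [cite: King1986, p.664 (pairing convention)] -/
theorem floorMap_add_smul_unitVec_of_le {R : ℕ} (hR : R ≠ 0) (φ : Tor A → Tor B) (hφ : ∀ x μ, (φ x μ).val = (x μ).val / R)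
    (hAB : ∀ μ, A μ = R * B μ) (z : Tor A) (κ : Fin (d + 1)) {j : ℕ} (hj : j ≤ R) :
    ∃ δ : ℕ, δ ≤ 1 ∧ φ (z + j • unitVec A κ) = φ z + δ • unitVec B κ := by
  refine ⟨((z κ).val % R + j) / R, ?_, ?_⟩
  · exact Nat.lt_succ_iff.mp (Nat.div_lt_of_lt_mul (by have := Nat.mod_lt (z κ).val (Nat.pos_of_ne_zero hR); omega))
  have hoff : ∀ μ, μ ≠ κ → φ (z + j • unitVec A κ) μ = φ z μ := fun μ hμ => by
    apply ZMod.val_injective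
    rw [hφ, hφ, show (z + j • unitVec A κ) μ = z μ by simp [unitVec, hμ]]
  have hφz : φ z κ = (((z κ).val / R : ℕ) : ZMod (B κ)) := by rw [← hφ, ZMod.natCast_zmod_val]
  have hdiv : ((z κ).val + j) / R = (z κ).val / R + ((z κ).val % R + j) / R := by
    conv_lhs => rw [← Nat.div_add_mod (z κ).val R, add_assoc, Nat.mul_add_div (Nat.pos_of_ne_zero hR)]
  have hon : φ (z + j • unitVec A κ) κ = (((z κ).val / R : ℕ) : ZMod (B κ)) + ((((z κ).val % R + j) / R : ℕ) : ZMod (B κ)) := by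
    have hstep : (z + j • unitVec A κ) κ = z κ + (j : ZMod (A κ)) := by simp [unitVec]
    have hval : ((z + j • unitVec A κ) κ).val = ((z κ).val + j) % A κ := by
      rw [hstep, ZMod.val_add, ZMod.val_natCast, Nat.add_mod_mod]
    have hmod : ((z κ).val + j) % A κ / R = ((z κ).val / R + ((z κ).val % R + j) / R) % B κ := by
      rw [congrArg (fun t => ((z κ).val + j) % t / R) (hAB κ), Nat.mod_mul_right_div_self, hdiv]
    calc φ (z + j • unitVec A κ) κ = (((φ (z + j • unitVec A κ) κ).val : ℕ) : ZMod (B κ)) := (ZMod.natCast_zmod_val _).symm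
      _ = _ := by rw [hφ, hval, hmod, ZMod.natCast_mod]; push_cast; ring
  funext μ
  by_cases hμ : μ = κ
  · subst hμ
    rw [Pi.add_apply, hon, hφz]
    simp [unitVec]
  · rw [Pi.add_apply, hoff μ hμ, Pi.smul_apply, show unitVec B κ μ = 0 by simp [unitVec, hμ], smul_zero, add_zero]

variable (M : Fin (d + 1) → ℕ) [∀ μ, NeZero (M μ)] (L k m : ℕ) [NeZero L]
/-- KING's PAIRING MOVES BY AT MOST ONE COARSE STEP IN `j ≤ L^m` FINE STEPS: `pr(x′ + je′_κ) ∈ {pr x′, pr x′ + e_κ}`. [cite: King1986, p.664 (pairing convention)] -/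
theorem kingPr_add_smul_unitVec_of_le (x' : Tor (fine (L ^ m * L ^ k) M)) (κ : Fin (d + 1)) {j : ℕ} (hj : j ≤ L ^ m) :
    ∃ δ : ℕ, δ ≤ 1 ∧ kingPr L k m M (x' + j • unitVec (fine (L ^ m * L ^ k) M) κ) = kingPr L k m M x' + δ • unitVec (fine (L ^ k) M) κ :=
  floorMap_add_smul_unitVec_of_le (pow_ne_zero m (NeZero.ne L)) (kingPr L k m M) (fun x μ => kingPr_val L k m M x μ)
    (fun _ => Nat.mul_assoc _ _ _) x' κ hj

/-- **SHIFTING A PROLONGATION BY `j ≤ L^m` FINE STEPS COSTS ONE COARSE DIFFERENCE**: `‖(τ′_{je′_κ} − 1)(Pu)‖_∞ ≤ ‖(τ_{e_κ} − 1)u‖_∞`. [folklore] -/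
theorem norm_symbOp_sT_pow_sub_one_pull_le (κ : Fin (d + 1)) {j : ℕ} (hj : j ≤ L ^ m) (u : Tor (fine (L ^ k) M) × Fin (d + 1) → ℝ) :
    ‖symbOp M (L ^ m * L ^ k) (sT M (L ^ m * L ^ k) κ ^ j - 1) (pull (kingPrV L k m M) u)‖ ≤
      ‖symbOp M (L ^ k) (sT M (L ^ k) κ - 1) u‖ := by
  refine (pi_norm_le_iff_of_nonneg (norm_nonneg _)).mpr fun i => ?_
  have hpt : ∀ p : Tor (fine (L ^ k) M) × Fin (d + 1),
      ‖u (p.1 + unitVec (fine (L ^ k) M) κ, p.2) - u p‖ ≤ ‖symbOp M (L ^ k) (sT M (L ^ k) κ - 1) u‖ := fun p => by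
    have h := norm_le_pi_norm (symbOp M (L ^ k) (sT M (L ^ k) κ - 1) u) p
    have e : symbOp M (L ^ k) (sT M (L ^ k) κ - 1) u p = u (p.1 + unitVec (fine (L ^ k) M) κ, p.2) - u p := by
      rw [map_sub, map_one, LinearMap.sub_apply, Module.End.one_apply, Pi.sub_apply, symbOp_sT_apply]
    rw [e] at h
    exact h
  rw [map_sub, map_one, LinearMap.sub_apply, Module.End.one_apply, Pi.sub_apply, symbOp_sT_pow_apply, pull_apply, pull_apply, kingPrV_eq,
    kingPrV_eq]
  obtain ⟨δ, hδ, hpr⟩ := kingPr_add_smul_unitVec_of_le M L k m i.1 κ hj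
  rw [hpr]
  interval_cases δ
  · simp
  · simpa using hpt (kingPr L k m M i.1, i.2)

/-- **THE BOX FILTER OF A PROLONGATION COSTS ONE COARSE DIFFERENCE**: `‖(A_κ − 1)(Pu)‖_∞ ≤ ‖(τ_{e_κ} − 1)u‖_∞` (uniformly in `m`). [folklore] -/
theorem norm_symbOp_sA_sub_one_pull_le (κ : Fin (d + 1)) (u : Tor (fine (L ^ k) M) × Fin (d + 1) → ℝ) :
    ‖symbOp M (L ^ m * L ^ k) (sA M (L ^ m * L ^ k) κ (L ^ m) - 1) (pull (kingPrV L k m M) u)‖ ≤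
      ‖symbOp M (L ^ k) (sT M (L ^ k) κ - 1) u‖ := by
  have hR : (L ^ m : ℕ) ≠ 0 := pow_ne_zero m (NeZero.ne L)
  have hR' : (0 : ℝ) < (L ^ m : ℕ) := by exact_mod_cast Nat.pos_of_ne_zero hR
  have hsplit : sA M (L ^ m * L ^ k) κ (L ^ m) - 1 = ((L ^ m : ℕ) : ℝ)⁻¹ • ∑ j ∈ range (L ^ m), (sT M (L ^ m * L ^ k) κ ^ j - 1) := by
    rw [sum_sub_distrib, sum_const, card_range, smul_sub, sA, ← Nat.cast_smul_eq_nsmul ℝ, smul_smul, inv_mul_cancel₀ hR'.ne', one_smul]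
  rw [hsplit, map_smul, LinearMap.smul_apply, norm_smul, norm_inv, Real.norm_natCast, map_sum, LinearMap.sum_apply]
  calc ((L ^ m : ℕ) : ℝ)⁻¹ * ‖∑ j ∈ range (L ^ m), symbOp M (L ^ m * L ^ k) (sT M (L ^ m * L ^ k) κ ^ j - 1) (pull (kingPrV L k m M) u)‖
      ≤ ((L ^ m : ℕ) : ℝ)⁻¹ * ∑ j ∈ range (L ^ m), ‖symbOp M (L ^ k) (sT M (L ^ k) κ - 1) u‖ := by
        gcongr
        exact (norm_sum_le _ _).trans (sum_le_sum fun j hj => norm_symbOp_sT_pow_sub_one_pull_le M L k m κ (mem_range.mp hj).le u)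
    _ = ‖symbOp M (L ^ k) (sT M (L ^ k) κ - 1) u‖ := by
        rw [sum_const, card_range, nsmul_eq_mul, ← mul_assoc, inv_mul_cancel₀ hR'.ne', one_mul]

/-- **THE SMOOTHED PROLONGATION DIFFERS FROM KING's BY COARSE DIFFERENCES**: `‖(P̂₂ − P)u‖_∞ ≤ 2·Σ_ν ‖(τ_{e_ν} − 1)u‖_∞` — uniformly in `m`; at `u = Gλ` this is
`2(d+1)·η·sup|∇Gλ|`, the (1.110) gradient entry. [folklore] -/
theorem norm_symbOp_sSm_sub_one_pull_le (u : Tor (fine (L ^ k) M) × Fin (d + 1) → ℝ) :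
    ‖symbOp M (L ^ m * L ^ k) (sSm M (L ^ m * L ^ k) (L ^ m) - 1) (pull (kingPrV L k m M) u)‖ ≤
      2 * ∑ ν : Fin (d + 1), ‖symbOp M (L ^ k) (sT M (L ^ k) ν - 1) u‖ := by
  have hR : (L ^ m : ℕ) ≠ 0 := pow_ne_zero m (NeZero.ne L)
  -- telescope the product: `Πa² − 1 = Σ_ν (a_ν² − 1)Π_{ν′<ν}a²` and `a² − 1 = (a + 1)(a − 1)`
  have htel : sSm M (L ^ m * L ^ k) (L ^ m) - 1 = ∑ ν : Fin (d + 1), (sA M (L ^ m * L ^ k) ν (L ^ m) + 1) *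
      (∏ ν' ∈ univ.filter (· < ν), sA M (L ^ m * L ^ k) ν' (L ^ m) ^ 2) * (sA M (L ^ m * L ^ k) ν (L ^ m) - 1) := by
    have h := prod_one_sub_ordered (univ : Finset (Fin (d + 1))) fun ν => 1 - sA M (L ^ m * L ^ k) ν (L ^ m) ^ 2
    simp only [sub_sub_cancel] at h
    rw [sSm, h, sub_sub_cancel_left, ← sum_neg_distrib]
    exact sum_congr rfl fun ν _ => by ring
  rw [htel, map_sum, LinearMap.sum_apply, mul_sum]
  refine (norm_sum_le _ _).trans (sum_le_sum fun ν _ => ?_)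
  rw [map_mul, map_mul, Module.End.mul_apply, Module.End.mul_apply, add_comm (sA M (L ^ m * L ^ k) ν (L ^ m)) 1]
  refine (norm_symbOp_one_add_sA_le M (L ^ m * L ^ k) ν hR _).trans (mul_le_mul_of_nonneg_left ?_ zero_le_two)
  exact (norm_symbOp_prod_sA_sq_le M (L ^ m * L ^ k) hR _ _).trans (norm_symbOp_sA_sub_one_pull_le M L k m ν u)

/-- ★ **THE LAPLACIAN CONSISTENCY OPERATORS ARE `O(η)`**: with `c′ = L^kL^m = η′⁻¹` and `R = L^m`, `‖ρ′(k_ν)w‖ ≤ 2L^{−k}‖w‖ = 2η‖w‖` — so each divergence term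
of `lap_sSm_comm_comp_pull` reads `∂′_ν h_ν` with `‖h_ν‖ ≤ 2η·‖P(∂_ν²u)‖ = 2‖∂_νu(· + e_ν) − ∂_νu‖_∞`, a DIFFERENCE OF GRADIENTS (never `η|∇∇u|` alone, never
`η⁻¹`). [folklore] -/
theorem norm_symbOp_sK_fine_le (ν : Fin (d + 1)) (w : Tor (fine (L ^ m * L ^ k) M) × Fin (d + 1) → ℝ) :
    ‖symbOp M (L ^ m * L ^ k) (sK M (L ^ m * L ^ k) ν (L ^ m) ((L : ℝ) ^ k * (L : ℝ) ^ m)) w‖ ≤ 2 * ((L : ℝ) ^ k)⁻¹ * ‖w‖ := by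
  have hL : (0 : ℝ) < L := by exact_mod_cast Nat.pos_of_ne_zero (NeZero.ne L)
  have hLk : (0 : ℝ) < (L : ℝ) ^ k := pow_pos hL k
  have hLm : (0 : ℝ) < (L : ℝ) ^ m := pow_pos hL m
  refine (norm_symbOp_sK_le M (L ^ m * L ^ k) (pow_ne_zero m (NeZero.ne L)) (mul_pos hLk hLm) ν w).trans ?_
  refine mul_le_mul_of_nonneg_right ?_ (norm_nonneg w)
  rw [Nat.cast_pow, div_le_iff₀ (mul_pos hLk hLm), mul_assoc, ← mul_assoc (((L : ℝ) ^ k)⁻¹), inv_mul_cancel₀ hLk.ne', one_mul]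
  linarith
end SwapBounds
end Summit.QuantumFields.YangMills.BalabanUVNodes.N15.TwoGrid
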